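import Summits.QuantumFields.BalabanUV.T4Continuum.Support.NE7SliceStepErrorSizes
import Summits.QuantumFields.BalabanUV.T4Continuum.Support.NE7RightInverseLinear
import Summits.QuantumFields.BalabanUV.T4Continuum.Support.NE3RightInverseLetters
import Summits.QuantumFields.BalabanUV.T4Continuum.Support.NE3EnergyHessBilin
import Summits.QuantumFields.BalabanUV.T4Continuum.Support.AveragingDeficitTransport
import HarnessLib

/-!
# NE7SliceStepErrorField — THE ERROR FIELD `E′ := J + N⁰ − N¹ = J + rightInvW(φ⁰ − φ¹)` OF ONE (S1) STEP, SIZED IN SUP NORM AND IN CURL (memo ROAD-G100 §2.6–§2.7, item F3c, first half):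
# `‖E′‖ ≤ e_J + (supC∕(M(1−θ)))·e_φ`, `‖curl_W E′‖ ≤ c_J + (supCurlC∕(M²(1−θ)))·e_φ` off the diagonal, `e_φ := (3+12d)·M·e_J + 2e_c`

Cell `pub-balaban`, rung (B)+1 sub-cell t4, lineage `b2b-balaban-t4-ne7-p1`, generation 101 (CRUX PROVER NE7 #1 = OWNER of BINDER row NE7).  Memo `t4/b2b-balaban-t4-ne7-p1-g101/ROAD-G101.md`.
Notation of the step (`NE7SliceStepIdentities`, `NE7SliceStepErrorSizes`): bond junk `J` (skew, `(tower)`-periodic, `‖J‖ ≤ e_J`, `‖curl_W J‖ ≤ c_J` off the diagonal), corner junk `j_c`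
(`‖j_c‖ ≤ e_c`), coarse data `φ⁰, φ¹` (skew, `N`-periodic) with `φ⁰ − φ¹ = −dirIter J + gaugeDir_V j_c` (`phi_sub_phi_succ`), normal parts `N^i := rightInvW φ^i`.  THIS FILE sizes the error
field `E′ := J + (N⁰ − N¹)` that the next split consumes (`NE7SliceStepContraction.split_error_sized`): linearity `N⁰ − N¹ = rightInvW(φ⁰ − φ¹)` (`NE7RightInverseLinear.rightInvW_sub`), the
datum size `‖φ⁰ − φ¹‖ ≤ e_φ` (`sup_dphi_le`), and the right-inverse sup letters (R5) `rightInvW_R5` ∕ (R6′) `norm_curl_rightInvW_le` of `NE3RightInverseLetters`; (R6′) is stated on indexed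
plaquettes (`μ < ν`), so §1 supplies the swap `‖curlAt W Y z ν μ‖ = ‖curlAt W Y z μ ν‖` for unitary `W` (`curlAt z ν μ = −Ad_u(curlAt z μ ν)`, `u` the reversed plaquette transport).
WHAT ([folklore]; 0 def, 0 sorry).
§1 `curlAt_swap`, **`norm_curlAt_swap`**, `norm_curlAt_le_of_plaq` (a bound on `‖curl W Y p‖` over `Plaq d` is a bound on `‖curlAt W Y z μ ν‖` for all `μ ≠ ν`).
§2 (multi-level small-field class at level `k+1`, `W` unitary `(tower L N (k+1))`-periodic, `cruxC·(M²x) < 1`, `M²x ≤ 1`, `curvSum ≤ 2L∕3`) `errorField_skew`, `errorField_periodic`,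
   **`norm_errorField_le`** (`‖E′‖ ≤ e_J + supC∕(M(1−θ))·e_φ`), **`norm_curlAt_errorField_le`** (`‖curlAt W E′ z μ ν‖ ≤ c_J + supCurlC∕(M²(1−θ))·e_φ`, `μ ≠ ν`).
HONEST FRAMING (page 1): linear bookkeeping over landed letters at ONE background; nothing of Bałaban's asserted; NOT the contraction, NOT (S1), NOT NE7; spine 0∕9; finite T⁴ rung (B)+1 — NOT infinite
volume, NOT mass gap, NOT BetaPertH, NOT Clay.  Continuum YM on T⁴ ⇐ BetaPertH ∧ nine spine estimates (0/9 proved); BetaPertH ⇐ (D1) ∧ (D4) ∧ CAP+tail; G-an2-4 gates asym, D1 and NE2/3/4.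
-/

set_option autoImplicit false

open scoped BigOperators Matrix.Norms.L2Operator
open Finset

namespace Summit.QuantumFields.BalabanUV.T4Continuum.NE7SliceStepErrorField

open Literature.MathematicalPhysics.QuantumFieldTheory.Balaban1983to89
open B7Prop1Explicit B7Prop2Explicit
open T4AveragingDeficitWall (IsUnitaryCfg IsSkewDir SmallField Ad curlAt curl)
open T4AveragingDeficitWallBoundary (IsPeriodicCfg)
open T4AveragingDeficitNonAbelian (Ad_mul Ad_sub)
open AveragingDeficitNearIdentity (Ad_add)
open AveragingDeficitTransport (norm_Ad_of_unitary)
open AveragingDeficitPeriodicCounting (IsPeriodicDir)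
open AveragingDeficitMultiLevelPrep (cavgIter LevelSmall tower)
open BlockAveragePushDirGauge (gaugeDir)
open NE3TangentCovariantTower (dirIter)
open NE3QbarIterCovLiftPrep (cruxC)
open NE3SmoothRightInverseW (rightInvW isSkewDir_rightInvW isPeriodicDir_rightInvW)
open NE3RightInverseSupLetters (supC)
open NE3HatInvCurlLetters (supCurlC)
open NE3RightInverseLetters (rightInvW_R5 norm_curl_rightInvW_le)
open NE7RightInverseLinear (rightInvW_sub)
open NE3LinearisedAverageSup (curvSum)
open NE3EnergyHessBilin (curlAt_add)
open NE7SliceStepErrorSizes (sup_dphi_le)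

noncomputable section

variable {d : ℕ} {n : Type*} [Fintype n] [DecidableEq n]

/-! ## §1 The swap of the dressed curl -/

/-- **THE SWAP OF THE DRESSED CURL**: `curlAt V ψ z ν μ = −Ad_u (curlAt V ψ z μ ν)` with `u := V(z,ν)·V(z+e_ν,μ)·V(z+e_μ,ν)⁻¹·V(z,μ)⁻¹` (the transport around the plaquette in the
reversed orientation). [folklore] -/
theorem curlAt_swap (V : Site d → Fin d → (Matrix n n ℂ)ˣ) (ψ : Site d → Fin d → Matrix n n ℂ) (z : Site d) (μ ν : Fin d) :
    curlAt V ψ z ν μ = -Ad (V z ν * V (z + e ν) μ * (V (z + e μ) ν)⁻¹ * (V z μ)⁻¹) (curlAt V ψ z μ ν) := by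
  rw [curlAt, curlAt, Ad_sub, Ad_sub, Ad_add, ← Ad_mul, ← Ad_mul, ← Ad_mul, ← Ad_mul]
  have e1 : V z ν * V (z + e ν) μ * (V (z + e μ) ν)⁻¹ * (V z μ)⁻¹ * V z μ = V z ν * V (z + e ν) μ * (V (z + e μ) ν)⁻¹ := by group
  have e2 : V z ν * V (z + e ν) μ * (V (z + e μ) ν)⁻¹ * (V z μ)⁻¹ * (V z μ * V (z + e μ) ν) = V z ν * V (z + e ν) μ := by group
  have e3 : V z ν * V (z + e ν) μ * (V (z + e μ) ν)⁻¹ * (V z μ)⁻¹ * (V z μ * V (z + e μ) ν * (V (z + e ν) μ)⁻¹) = V z ν := by group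
  rw [e1, e2, e3]
  abel

/-- **THE NORM OF THE DRESSED CURL IS SYMMETRIC IN THE PLANE** for a unitary configuration: `‖curlAt V ψ z ν μ‖ = ‖curlAt V ψ z μ ν‖`. [folklore] -/
theorem norm_curlAt_swap {V : Site d → Fin d → (Matrix n n ℂ)ˣ} (hV : IsUnitaryCfg V) (ψ : Site d → Fin d → Matrix n n ℂ) (z : Site d) (μ ν : Fin d) :
    ‖curlAt V ψ z ν μ‖ = ‖curlAt V ψ z μ ν‖ := by
  rw [curlAt_swap, norm_neg, norm_Ad_of_unitary]
  exact (unitaryUnits _).mul_mem ((unitaryUnits _).mul_mem ((unitaryUnits _).mul_mem (hV _ _) (hV _ _)) ((unitaryUnits _).inv_mem (hV _ _)))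
    ((unitaryUnits _).inv_mem (hV _ _))

/-- a bound on the indexed-plaquette curl `‖curl V Y p‖` (`p : Plaq d`, planes `μ < ν`) of a unitary configuration bounds `‖curlAt V Y z μ ν‖` for all `μ ≠ ν`. [folklore] -/
theorem norm_curlAt_le_of_plaq {V : Site d → Fin d → (Matrix n n ℂ)ˣ} (hV : IsUnitaryCfg V) {Y : Site d → Fin d → Matrix n n ℂ} {c : ℝ}
    (h : ∀ p : T4AveragingDeficitWall.Plaq d, ‖curl V Y p‖ ≤ c) (z : Site d) {μ ν : Fin d} (hμν : μ ≠ ν) : ‖curlAt V Y z μ ν‖ ≤ c := by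
  rcases lt_or_gt_of_ne hμν with hlt | hgt
  · exact h (z, ⟨(μ, ν), hlt⟩)
  · rw [← norm_curlAt_swap hV]
    exact h (z, ⟨(ν, μ), hgt⟩)

/-! ## §2 The error field of one step, sized -/

omit [Fintype n] [DecidableEq n] in
/-- the difference of two skew bond fields is skew. [folklore] -/
theorem isSkewDir_sub {φ ψ : Site d → Fin d → Matrix n n ℂ} (hφ : IsSkewDir φ) (hψ : IsSkewDir ψ) : IsSkewDir (fun y μ => φ y μ - ψ y μ) :=
  fun y μ => (skewAdjoint _).sub_mem (hφ y μ) (hψ y μ)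

section ErrorField

variable [Nonempty n] {L : ℕ} (hL : 2 ≤ L) (k : ℕ) {N : ℕ} [NeZero N] {W : Site d → Fin d → (Matrix n n ℂ)ˣ} {x : ℝ}
  (hWu : IsUnitaryCfg W) (hWP : IsPeriodicCfg W ((tower L N (k + 1) : ℕ) : ℤ)) (hx : 0 ≤ x) (hs : LevelSmall d L k x) (hWx : SmallField W x)
  (hθ : cruxC d L * (((L : ℝ) ^ (k + 1)) ^ 2 * x) < 1) (hε : ((L : ℝ) ^ (k + 1)) ^ 2 * x ≤ 1)
  {φ0 φ1 : Site d → Fin d → Matrix n n ℂ} (hφ0 : IsSkewDir φ0) (hφ1 : IsSkewDir φ1)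
  {J : Site d → Fin d → Matrix n n ℂ}

/-- **THE ERROR FIELD IS SKEW** (`J` skew). [folklore] -/
theorem errorField_skew (hJs : IsSkewDir J) :
    IsSkewDir (fun y κ => J y κ + (rightInvW hL k hWu hx hs hWx N hθ hφ0 y κ - rightInvW hL k hWu hx hs hWx N hθ hφ1 y κ)) := fun y κ =>
  (skewAdjoint _).add_mem (hJs y κ) ((skewAdjoint _).sub_mem (isSkewDir_rightInvW hL k hWu hx hs hWx hθ hφ0 y κ) (isSkewDir_rightInvW hL k hWu hx hs hWx hθ hφ1 y κ))

include hWP in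
/-- **THE ERROR FIELD IS `(tower L N (k+1))`-PERIODIC** (`J` periodic, `W` periodic). [folklore] -/
theorem errorField_periodic (hJP : IsPeriodicDir J ((tower L N (k + 1) : ℕ) : ℤ)) :
    IsPeriodicDir (fun y κ => J y κ + (rightInvW hL k hWu hx hs hWx N hθ hφ0 y κ - rightInvW hL k hWu hx hs hWx N hθ hφ1 y κ)) ((tower L N (k + 1) : ℕ) : ℤ) := by
  intro y i μ
  have h0 := isPeriodicDir_rightInvW hL k hWu hWP hx hs hWx hθ hφ0 y i μ
  have h1 := isPeriodicDir_rightInvW hL k hWu hWP hx hs hWx hθ hφ1 y i μ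
  simp only [hJP y i μ, h0, h1]

include hWP hε in
/-- **THE SUP SIZE OF THE ERROR FIELD**: with `φ⁰ − φ¹ = −dirIter J + gaugeDir_V j_c`, `‖J‖ ≤ e_J`, `‖j_c‖ ≤ e_c` (`J` skew periodic, `curvSum ≤ 2L∕3`, `M²x ≤ 1`),
`‖E′(b)‖ ≤ e_J + supC∕(M·(1 − cruxC·M²x))·((3+12d)·M·e_J + 2e_c)` (`M = L^{k+1}`). [folklore] -/
theorem norm_errorField_le (hA : curvSum d L (k + 1) x ≤ 2 / 3 * L) (hJs : IsSkewDir J) (hJP : IsPeriodicDir J ((tower L N (k + 1) : ℕ) : ℤ))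
    {jc : Site d → Matrix n n ℂ} (hdφ : ∀ z κ, φ0 z κ - φ1 z κ = -dirIter L (k + 1) W J z κ + gaugeDir (cavgIter L (k + 1) W) jc z κ)
    {eJ ec : ℝ} (heJ0 : 0 ≤ eJ) (hec0 : 0 ≤ ec) (hJ : ∀ y κ, ‖J y κ‖ ≤ eJ) (hjc : ∀ z, ‖jc z‖ ≤ ec) (y : Site d) (κ : Fin d) :
    ‖J y κ + (rightInvW hL k hWu hx hs hWx N hθ hφ0 y κ - rightInvW hL k hWu hx hs hWx N hθ hφ1 y κ)‖
      ≤ eJ + supC d L / ((L : ℝ) ^ (k + 1) * (1 - cruxC d L * (((L : ℝ) ^ (k + 1)) ^ 2 * x))) * ((3 + 12 * (d : ℝ)) * (L : ℝ) ^ (k + 1) * eJ + 2 * ec) := by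
  have hφψ : IsSkewDir (fun y μ => φ0 y μ - φ1 y μ) := isSkewDir_sub hφ0 hφ1
  have hsub := rightInvW_sub (N := N) hL k hWu hx hs hWx hθ hφ0 hφ1 hφψ y κ
  rw [← hsub]
  have hφs : ∀ (z : Site d) (μ : Fin d), ‖(fun y μ => φ0 y μ - φ1 y μ) z μ‖ ≤ (3 + 12 * (d : ℝ)) * (L : ℝ) ^ (k + 1) * eJ + 2 * ec := fun z μ => by
    simp only [hdφ z μ]
    exact sup_dphi_le hL k hWu hWP hx hs hWx hA hJs hJP heJ0 hJ hjc z μ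
  have hs0 : 0 ≤ (3 + 12 * (d : ℝ)) * (L : ℝ) ^ (k + 1) * eJ + 2 * ec := by positivity
  exact (norm_add_le _ _).trans (add_le_add (hJ y κ) (rightInvW_R5 hL k hWu hx hs hWx hθ hε hφψ hs0 hφs y κ))

include hWP hε in
/-- **THE CURL SIZE OF THE ERROR FIELD** (same data, `‖curlAt W J z μ ν‖ ≤ c_J` for `μ ≠ ν`): for `μ ≠ ν`,
`‖curlAt W E′ z μ ν‖ ≤ c_J + supCurlC∕(M²·(1 − cruxC·M²x))·((3+12d)·M·e_J + 2e_c)`. [folklore] -/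
theorem norm_curlAt_errorField_le (hA : curvSum d L (k + 1) x ≤ 2 / 3 * L) (hJs : IsSkewDir J) (hJP : IsPeriodicDir J ((tower L N (k + 1) : ℕ) : ℤ))
    {jc : Site d → Matrix n n ℂ} (hdφ : ∀ z κ, φ0 z κ - φ1 z κ = -dirIter L (k + 1) W J z κ + gaugeDir (cavgIter L (k + 1) W) jc z κ)
    {eJ cJ ec : ℝ} (heJ0 : 0 ≤ eJ) (hec0 : 0 ≤ ec) (hJ : ∀ y κ, ‖J y κ‖ ≤ eJ)
    (hcJ : ∀ (z : Site d) (μ ν : Fin d), μ ≠ ν → ‖curlAt W J z μ ν‖ ≤ cJ) (hjc : ∀ z, ‖jc z‖ ≤ ec) (z : Site d) {μ ν : Fin d} (hμν : μ ≠ ν) :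
    ‖curlAt W (fun y κ => J y κ + (rightInvW hL k hWu hx hs hWx N hθ hφ0 y κ - rightInvW hL k hWu hx hs hWx N hθ hφ1 y κ)) z μ ν‖
      ≤ cJ + supCurlC d L / (((L : ℝ) ^ (k + 1)) ^ 2 * (1 - cruxC d L * (((L : ℝ) ^ (k + 1)) ^ 2 * x))) * ((3 + 12 * (d : ℝ)) * (L : ℝ) ^ (k + 1) * eJ + 2 * ec) := by
  have hφψ : IsSkewDir (fun y μ => φ0 y μ - φ1 y μ) := isSkewDir_sub hφ0 hφ1
  have hfun : (fun y κ => J y κ + (rightInvW hL k hWu hx hs hWx N hθ hφ0 y κ - rightInvW hL k hWu hx hs hWx N hθ hφ1 y κ))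
      = J + rightInvW hL k hWu hx hs hWx N hθ hφψ := by
    funext y κ
    rw [Pi.add_apply, Pi.add_apply, rightInvW_sub (N := N) hL k hWu hx hs hWx hθ hφ0 hφ1 hφψ y κ]
  rw [hfun, curlAt_add]
  have hφs : ∀ (z : Site d) (μ : Fin d), ‖(fun y μ => φ0 y μ - φ1 y μ) z μ‖ ≤ (3 + 12 * (d : ℝ)) * (L : ℝ) ^ (k + 1) * eJ + 2 * ec := fun z μ => by
    simp only [hdφ z μ]
    exact sup_dphi_le hL k hWu hWP hx hs hWx hA hJs hJP heJ0 hJ hjc z μ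
  have hs0 : 0 ≤ (3 + 12 * (d : ℝ)) * (L : ℝ) ^ (k + 1) * eJ + 2 * ec := by positivity
  have hR : ‖curlAt W (rightInvW hL k hWu hx hs hWx N hθ hφψ) z μ ν‖
      ≤ supCurlC d L / (((L : ℝ) ^ (k + 1)) ^ 2 * (1 - cruxC d L * (((L : ℝ) ^ (k + 1)) ^ 2 * x))) * ((3 + 12 * (d : ℝ)) * (L : ℝ) ^ (k + 1) * eJ + 2 * ec) :=
    norm_curlAt_le_of_plaq hWu (fun p => norm_curl_rightInvW_le hL k hWu hx hs hWx hθ hε hφψ hs0 hφs p) z hμν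
  exact (norm_add_le _ _).trans (add_le_add (hcJ z μ ν hμν) hR)

end ErrorField

end

end Summit.QuantumFields.BalabanUV.T4Continuum.NE7SliceStepErrorField
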